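import Summits.QuantumFields.QCD.Theses.HeatSlicedQuarks
import Literature.MathematicalPhysics.QuantumLattice.LatticeToriProofs

/-!
# Image sum for stub `stub_tracedCoreAssembly` of line `Sketch`
(crux `Summit.QuantumFields.QCD.Theses.HeatSlicedQuarks.TracedQuadraticParametrix`, item stmt-QuantumFields-17985)

**Exponential (Davies–Gaffney) image sum in the core regime.**  Let `π : T_{NL} → T_L` be the
coordinatewise reduction `(ℤ/NLℤ)⁴ → (ℤ/Lℤ)⁴` (`ZMod.castHom`) of the `N⁴`-sheeted covering of the
discrete four-torus and `d` the periodic sup-distance `torusDist` of `T_{NL}`.  For every `c > 0`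
there is `C = C(c)` such that for every site `x̃ ∈ T_{NL}` and every time `t` in the core regime
`1 ≤ t`, `t (1 + log t)² ≤ L²`,

  `Σ_{z̃ : π z̃ = π x̃, z̃ ≠ x̃} exp(-c d(x̃,z̃)²/(t + d(x̃,z̃))) ≤ C / L⁴`.

## Proof

1. *Deck structure* (adapted from `…StubImageSum.lean`): the images are `x̃ + L k`, `k ∈ T_N ∖ {0}`,
   at distance `d = L ‖k‖`, `‖k‖ ≥ 1` (`torusDist_deck`, `deck_inj`, `one_le_torusNorm_deck`).
2. *Termwise*: with `n = ‖k‖ ≥ 1` and `s = L²/(t+L) ≥ 1/2` (the regime gives `t ≤ L²`),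
   `d²/(t+d) = (Ln)²/(t+Ln) ≥ n s ≥ s + (n-1)/2`, so
   `exp(-c d²/(t+d)) ≤ e^{-cs} e^{c/2} · n e^{-(c/2) n}` (`term_le`).
3. *Radial summation* on `T_N` (`sum_radial_le`, sphere count `card_filter_torusDist_eq_le`,
   `≤ 8(2n+1)³ ≤ 216 n³` sites with `‖k‖ = n ≥ 1`): `Σ_n 216 n⁴ e^{-(c/2) n} ≤ S(c) < ∞`
   (`Real.summable_pow_mul_exp_neg_nat_mul`), the term `n = 0` contributing `0`.
4. *Absorption* (`core_absorb`): `L⁴ e^{-cs} ≤ 384/c⁴ + 32 e^{4/c}/c²`: if `t ≤ L` then `s ≥ L/2`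
   and `L⁴e^{-cL/2} ≤ 4!(2/c)⁴`; if `L < t` then `s ≥ σ/2`, `σ = L²/t ≥ (1 + log t)²`, `L⁴ = σ²t²`,
   `σ² e^{-cσ/4} ≤ 2!(4/c)²` and `t² e^{-cσ/4} ≤ e^{2u - c(1+u)²/4} ≤ e^{4/c}` (`u = log t ≥ 0`).

Leans on: `torusNorm`, `torusDist`, `torusDist_comm'`, `torusDist_lt`, `card_filter_torusDist_eq_le`,
`sum_radial_le` (tree, `LatticeTori` / `LatticeToriProofs`); `Real.pow_div_factorial_le_exp`,
`Real.summable_pow_mul_exp_neg_nat_mul`, `Summable.sum_le_tsum`, `ZMod` API (Mathlib).  No named facts.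
-/

namespace Summit.QuantumFields.QCD.Cruxes.TracedQuadraticParametrix.Sketch

open Literature.MathematicalPhysics.QuantumLattice Literature.MathematicalPhysics.QuantumFieldTheory
  Literature.Probability.LatticeModels
open Summit.QuantumFields.QCD.Theses.HeatSlicedQuarks
open scoped Matrix

/-! ### The torus norm and the fibres of the covering map
(adapted from Summits/QuantumFields/QCD/Theorems/HeatSlicedQuarksInterleavedHeatSliceFlowStubImageSum.lean) -/

/-- On a cubic torus with nonzero side, only the origin has periodic sup-norm `0`. -/
private theorem eq_zero_of_torusNorm_eq_zero {d n : ℕ} [NeZero n] {k : TorusSite d n}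
    (h : torusNorm k = 0) : k = 0 := by
  -- adapted from …StubImageSum.lean
  funext μ
  have hμ : min (k μ).val (n - (k μ).val) ≤ 0 :=
    h ▸ Finset.le_sup (f := fun i => min (k i).val (n - (k i).val)) (Finset.mem_univ μ)
  have hlt := ZMod.val_lt (k μ)
  have h0 : (k μ).val = 0 := by omega
  exact (ZMod.val_eq_zero _).mp h0

/-- If every coordinate representative of `w ∈ T_{NL}` is `L` times that of `k ∈ T_N`, then
`‖w‖ = L · ‖k‖` for the periodic sup-norms. -/
private theorem torusNorm_eq_mul {d N L : ℕ} [NeZero N] (w : TorusSite d (N * L)) (k : TorusSite d N)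
    (h : ∀ μ, (w μ).val = L * (k μ).val) : torusNorm w = L * torusNorm k := by
  -- adapted from …StubImageSum.lean
  have hmono : Monotone fun t : ℕ => L * t := fun a b hab => Nat.mul_le_mul_left L hab
  simp only [torusNorm]
  rw [Finset.apply_sup_eq_sup_comp_of_linearOrder (fun t : ℕ => L * t) hmono (mul_zero L)]
  congr 1
  funext μ
  simp only [Function.comp_apply, h μ]
  rw [show N * L - L * (k μ).val = L * (N - (k μ).val) by rw [mul_tsub, mul_comm N L]]
  exact (hmono.map_min).symm

/-- The kernel of the reduction `ZMod (N L) → ZMod L` consists of the classes whose representative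
is a multiple of `L`. -/
private theorem dvd_val_of_castHom_eq_zero {N L : ℕ} [NeZero (N * L)] {a : ZMod (N * L)}
    (h : ZMod.castHom (dvd_mul_left L N) (ZMod L) a = 0) : L ∣ a.val := by
  -- adapted from …StubImageSum.lean
  rw [ZMod.castHom_apply, ZMod.cast_eq_val] at h
  exact (ZMod.natCast_eq_zero_iff _ _).mp h

/-- `N ≠ 0` when `N L ≠ 0`. -/
private theorem neZero_left {N L : ℕ} [NeZero (N * L)] : NeZero N :=
  ⟨by rintro rfl; exact NeZero.ne (0 * L) (zero_mul L)⟩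

/-- Fibre coordinates: if `π z̃ = π x̃` then `((z̃ - x̃) μ).val = L · q_μ` with `q_μ < N` the
representative of the `μ`-th coordinate of the deck label `k(z̃) ∈ T_N`. -/
private theorem deck_coord {N L : ℕ} [NeZero (N * L)] {x z : TorusSite 4 (N * L)}
    (h : ∀ μ, ZMod.castHom (dvd_mul_left L N) (ZMod L) (z μ) =
      ZMod.castHom (dvd_mul_left L N) (ZMod L) (x μ)) (μ : Fin 4) :
    ((z - x) μ).val = L * ((((z - x) μ).val / L : ℕ) : ZMod N).val := by
  -- adapted from …StubImageSum.lean
  have hdvd : L ∣ ((z - x) μ).val :=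
    dvd_val_of_castHom_eq_zero (by rw [Pi.sub_apply, map_sub, sub_eq_zero]; exact h μ)
  have hlt : ((z - x) μ).val / L < N :=
    Nat.div_lt_of_lt_mul ((ZMod.val_lt _).trans_eq (Nat.mul_comm N L))
  rw [ZMod.val_cast_of_lt hlt, Nat.mul_div_cancel' hdvd]

/-- The deck label `k(z̃) ∈ T_N` determines the point of the fibre. -/
private theorem deck_inj {N L : ℕ} [NeZero (N * L)] {x z₁ z₂ : TorusSite 4 (N * L)}
    (h₁ : ∀ μ, ZMod.castHom (dvd_mul_left L N) (ZMod L) (z₁ μ) =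
      ZMod.castHom (dvd_mul_left L N) (ZMod L) (x μ))
    (h₂ : ∀ μ, ZMod.castHom (dvd_mul_left L N) (ZMod L) (z₂ μ) =
      ZMod.castHom (dvd_mul_left L N) (ZMod L) (x μ))
    (heq : ∀ μ, ((((z₁ - x) μ).val / L : ℕ) : ZMod N) = ((((z₂ - x) μ).val / L : ℕ) : ZMod N)) :
    z₁ = z₂ := by
  -- adapted from …StubImageSum.lean
  funext μ
  have e : ((z₁ - x) μ).val = ((z₂ - x) μ).val := by
    rw [deck_coord h₁ μ, deck_coord h₂ μ, heq μ]
  have := ZMod.val_injective _ e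
  rwa [Pi.sub_apply, Pi.sub_apply, sub_left_inj] at this

/-- Distances to deck images scale: `d(x̃, z̃) = L · ‖k(z̃)‖`. -/
private theorem torusDist_deck {N L : ℕ} [NeZero (N * L)] {x z : TorusSite 4 (N * L)}
    (h : ∀ μ, ZMod.castHom (dvd_mul_left L N) (ZMod L) (z μ) =
      ZMod.castHom (dvd_mul_left L N) (ZMod L) (x μ)) :
    torusDist x z =
      L * torusNorm (Ls := fun _ : Fin 4 => N) (fun μ => ((((z - x) μ).val / L : ℕ) : ZMod N)) := by
  -- adapted from …StubImageSum.lean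
  haveI : NeZero N := neZero_left (L := L)
  rw [torusDist_comm']
  unfold torusDist
  exact torusNorm_eq_mul (z - x) _ (fun μ => deck_coord h μ)

/-- A non-trivial deck image has deck label of norm `≥ 1`. -/
private theorem one_le_torusNorm_deck {N L : ℕ} [NeZero (N * L)] {x z : TorusSite 4 (N * L)}
    (h : ∀ μ, ZMod.castHom (dvd_mul_left L N) (ZMod L) (z μ) =
      ZMod.castHom (dvd_mul_left L N) (ZMod L) (x μ)) (hne : z ≠ x) :
    1 ≤ torusNorm (Ls := fun _ : Fin 4 => N) (fun μ => ((((z - x) μ).val / L : ℕ) : ZMod N)) := by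
  -- adapted from …StubImageSum.lean
  rcases Nat.eq_zero_or_pos
      (torusNorm (Ls := fun _ : Fin 4 => N) (fun μ => ((((z - x) μ).val / L : ℕ) : ZMod N)))
    with h0 | h0
  · exfalso
    apply hne
    have hd : torusDist x z = 0 := by rw [torusDist_deck h, h0, mul_zero]
    unfold torusDist at hd
    exact (sub_eq_zero.mp (eq_zero_of_torusNorm_eq_zero hd)).symm
  · exact h0

/-- A weighted injection bound: if `φ` is injective on `S`, maps `S` into `T`, `g ≤ G ∘ φ` on `S` and
`G ≥ 0` on `T`, then `Σ_S g ≤ Σ_T G`. -/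
private theorem sum_le_sum_of_injOn_nonneg {α β : Type*} [DecidableEq β] {S : Finset α}
    {T : Finset β} {g : α → ℝ} {G : β → ℝ} (φ : α → β) (hinj : Set.InjOn φ S)
    (hmaps : ∀ z ∈ S, φ z ∈ T) (hle : ∀ z ∈ S, g z ≤ G (φ z)) (hG : ∀ k ∈ T, 0 ≤ G k) :
    ∑ z ∈ S, g z ≤ ∑ k ∈ T, G k :=
  -- adapted from …StubImageSum.lean
  calc ∑ z ∈ S, g z ≤ ∑ z ∈ S, G (φ z) := Finset.sum_le_sum hle
    _ = ∑ k ∈ S.image φ, G k := (Finset.sum_image hinj).symm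
    _ ≤ ∑ k ∈ T, G k :=
        Finset.sum_le_sum_of_subset_of_nonneg (Finset.image_subset_iff.mpr hmaps)
          fun k hk _ => hG k hk

/-- Radial summation on the small torus `T_N` against the sphere count
`#{k : ‖k‖ = n} ≤ 8 (2n+1)³` (`sum_radial_le`, `card_filter_torusDist_eq_le` at the origin). -/
private theorem small_torus_sum (N : ℕ) [NeZero N] (F : ℕ → ℝ) (hF : ∀ n, 0 ≤ F n) :
    ∑ k : TorusSite 4 N, F (torusNorm k) ≤
      ∑ n ∈ Finset.range N, ((4 * (2 * (2 * n + 1) ^ 3) : ℕ) : ℝ) * F n := by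
  have h := sum_radial_le F hF (0 : TorusSite 4 N)
    (fun r => card_filter_torusDist_eq_le (by norm_num) 0 r) (fun u => torusDist_lt u 0)
  simp only [torusDist, sub_zero] at h
  exact h

/-! ### Real-number bookkeeping -/

/-- Polynomial against exponential: `y^k e^{-a y} ≤ k!/a^k` for `a > 0`, `y ≥ 0`
(from `xⁿ/n! ≤ eˣ`, `Real.pow_div_factorial_le_exp`). -/
private theorem pow_mul_exp_neg_le {a y : ℝ} (ha : 0 < a) (hy : 0 ≤ y) (k : ℕ) :
    y ^ k * Real.exp (-(a * y)) ≤ (k.factorial : ℝ) / a ^ k := by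
  have h := Real.pow_div_factorial_le_exp (x := a * y) (by positivity) k
  rw [div_le_iff₀ (by positivity)] at h
  rw [le_div_iff₀ (pow_pos ha k)]
  calc y ^ k * Real.exp (-(a * y)) * a ^ k = (a * y) ^ k * Real.exp (-(a * y)) := by ring
    _ ≤ Real.exp (a * y) * k.factorial * Real.exp (-(a * y)) :=
        mul_le_mul_of_nonneg_right h (Real.exp_pos _).le
    _ = k.factorial := by
        rw [mul_comm (Real.exp _), mul_assoc, ← Real.exp_add, add_neg_cancel, Real.exp_zero,
          mul_one]

/-- The numerical radial series: `Σ_{n < N} 8(2n+1)³ · n e^{-(c/2) n} ≤ 216 Σ_n n⁴ e^{-(c/2) n} =: S(c)`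
(the term `n = 0` vanishes; for `n ≥ 1`, `8(2n+1)³ ≤ 216 n³`). -/
private theorem radial_numeric {c : ℝ} (hc : 0 < c) :
    ∃ S : ℝ, 0 ≤ S ∧ ∀ N : ℕ, ∑ n ∈ Finset.range N,
      ((4 * (2 * (2 * n + 1) ^ 3) : ℕ) : ℝ) * ((n : ℝ) * Real.exp (-(c / 2) * n)) ≤ S := by
  have hsum : Summable (fun n : ℕ => (n : ℝ) ^ 4 * Real.exp (-(c / 2) * n)) :=
    Real.summable_pow_mul_exp_neg_nat_mul 4 (half_pos hc)
  have h0 : ∀ n : ℕ, 0 ≤ (n : ℝ) ^ 4 * Real.exp (-(c / 2) * n) := fun n => by positivity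
  refine ⟨216 * ∑' n : ℕ, (n : ℝ) ^ 4 * Real.exp (-(c / 2) * n),
    mul_nonneg (by norm_num) (tsum_nonneg h0), fun N => ?_⟩
  have hterm : ∀ n ∈ Finset.range N,
      ((4 * (2 * (2 * n + 1) ^ 3) : ℕ) : ℝ) * ((n : ℝ) * Real.exp (-(c / 2) * n)) ≤
        216 * ((n : ℝ) ^ 4 * Real.exp (-(c / 2) * n)) := by
    intro n _
    rcases Nat.eq_zero_or_pos n with rfl | hn
    · simp
    · have hn' : (1 : ℝ) ≤ n := by exact_mod_cast hn
      have h3 : (2 * (n : ℝ) + 1) ^ 3 ≤ (3 * n) ^ 3 := pow_le_pow_left₀ (by positivity) (by linarith) 3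
      have hE := (Real.exp_pos (-(c / 2) * n)).le
      push_cast
      calc (4 * (2 * (2 * (n : ℝ) + 1) ^ 3)) * ((n : ℝ) * Real.exp (-(c / 2) * n))
          ≤ (4 * (2 * (3 * (n : ℝ)) ^ 3)) * ((n : ℝ) * Real.exp (-(c / 2) * n)) := by
            gcongr
        _ = 216 * ((n : ℝ) ^ 4 * Real.exp (-(c / 2) * n)) := by ring
  calc _ ≤ ∑ n ∈ Finset.range N, 216 * ((n : ℝ) ^ 4 * Real.exp (-(c / 2) * n)) :=
        Finset.sum_le_sum hterm
    _ = 216 * ∑ n ∈ Finset.range N, ((n : ℝ) ^ 4 * Real.exp (-(c / 2) * n)) := by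
        rw [Finset.mul_sum]
    _ ≤ _ := mul_le_mul_of_nonneg_left (hsum.sum_le_tsum _ (fun n _ => h0 n)) (by norm_num)

/-- The core-regime absorption: for `1 ≤ t`, `1 ≤ L` and `t (1 + log t)² ≤ L²`,
`L⁴ exp(-c L²/(t+L)) ≤ 384/c⁴ + 32 e^{4/c}/c²`.  If `t ≤ L` then `L²/(t+L) ≥ L/2` and
`L⁴ e^{-cL/2} ≤ 4! (2/c)⁴`; if `L < t` then `L²/(t+L) ≥ σ/2` with `σ = L²/t ≥ (1 + log t)²`,
`L⁴ = σ² t²`, `σ² e^{-cσ/4} ≤ 2! (4/c)²` and `t² e^{-cσ/4} ≤ e^{2u - c(1+u)²/4} ≤ e^{4/c}`, `u = log t`. -/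
private theorem core_absorb {c : ℝ} (hc : 0 < c) {t L : ℝ} (ht : 1 ≤ t) (hL : 1 ≤ L)
    (hreg : t * (1 + Real.log t) ^ 2 ≤ L ^ 2) :
    L ^ 4 * Real.exp (-(c * (L ^ 2 / (t + L)))) ≤ 384 / c ^ 4 + 32 * Real.exp (4 / c) / c ^ 2 := by
  have ht0 : 0 < t := by linarith
  have hL0 : 0 < L := by linarith
  have hA : 0 ≤ 384 / c ^ 4 := by positivity
  have hB : 0 ≤ 32 * Real.exp (4 / c) / c ^ 2 := by positivity
  rcases le_or_gt t L with htL | hLt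
  · -- `t ≤ L`
    have hs : L / 2 ≤ L ^ 2 / (t + L) := by
      rw [div_le_div_iff₀ (by norm_num) (by positivity)]
      nlinarith
    calc L ^ 4 * Real.exp (-(c * (L ^ 2 / (t + L)))) ≤ L ^ 4 * Real.exp (-(c / 2 * L)) := by
          refine mul_le_mul_of_nonneg_left (Real.exp_le_exp.2 ?_) (by positivity)
          nlinarith [mul_le_mul_of_nonneg_left hs hc.le]
      _ ≤ (Nat.factorial 4 : ℝ) / (c / 2) ^ 4 := pow_mul_exp_neg_le (half_pos hc) hL0.le 4
      _ = 384 / c ^ 4 := by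
          rw [show (Nat.factorial 4 : ℝ) = 24 by norm_num [Nat.factorial]]
          field_simp
          norm_num
      _ ≤ _ := le_add_of_nonneg_right hB
  · -- `L < t`
    have hσ0 : 0 ≤ L ^ 2 / t := by positivity
    have hσreg : (1 + Real.log t) ^ 2 ≤ L ^ 2 / t := by
      rw [le_div_iff₀ ht0]
      linarith
    have hs : L ^ 2 / t / 2 ≤ L ^ 2 / (t + L) := by
      rw [div_div, div_le_div_iff₀ (by positivity) (by positivity)]
      nlinarith
    have hL4 : L ^ 4 = (L ^ 2 / t) ^ 2 * t ^ 2 := by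
      field_simp
    have hlog : 0 ≤ Real.log t := Real.log_nonneg ht
    have ht2 : t ^ 2 = Real.exp (2 * Real.log t) := by
      rw [show (2 : ℝ) * Real.log t = Real.log t + Real.log t by ring, Real.exp_add,
        Real.exp_log ht0]
      ring
    have h1 : (L ^ 2 / t) ^ 2 * Real.exp (-(c / 4 * (L ^ 2 / t))) ≤ 32 / c ^ 2 := by
      calc _ ≤ (Nat.factorial 2 : ℝ) / (c / 4) ^ 2 := pow_mul_exp_neg_le (by positivity) hσ0 2
        _ = 32 / c ^ 2 := by
          rw [show (Nat.factorial 2 : ℝ) = 2 by norm_num [Nat.factorial]]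
          field_simp
          norm_num
    have h2 : t ^ 2 * Real.exp (-(c / 4 * (L ^ 2 / t))) ≤ Real.exp (4 / c) := by
      have key : (2 * Real.log t - c / 4 * (1 + Real.log t) ^ 2) * c ≤ 4 := by
        nlinarith [sq_nonneg (c * (1 + Real.log t) - 4)]
      rw [← le_div_iff₀ hc] at key
      calc t ^ 2 * Real.exp (-(c / 4 * (L ^ 2 / t)))
          ≤ t ^ 2 * Real.exp (-(c / 4 * (1 + Real.log t) ^ 2)) := by
            refine mul_le_mul_of_nonneg_left (Real.exp_le_exp.2 ?_) (by positivity)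
            nlinarith [mul_le_mul_of_nonneg_left hσreg hc.le]
        _ = Real.exp (2 * Real.log t - c / 4 * (1 + Real.log t) ^ 2) := by
            rw [ht2, ← Real.exp_add]
            ring_nf
        _ ≤ Real.exp (4 / c) := Real.exp_le_exp.2 key
    calc L ^ 4 * Real.exp (-(c * (L ^ 2 / (t + L))))
        ≤ L ^ 4 * Real.exp (-(c * (L ^ 2 / t / 2))) := by
          refine mul_le_mul_of_nonneg_left (Real.exp_le_exp.2 ?_) (by positivity)
          nlinarith [mul_le_mul_of_nonneg_left hs hc.le]
      _ = ((L ^ 2 / t) ^ 2 * Real.exp (-(c / 4 * (L ^ 2 / t)))) *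
            (t ^ 2 * Real.exp (-(c / 4 * (L ^ 2 / t)))) := by
          rw [hL4, show -(c * (L ^ 2 / t / 2)) = -(c / 4 * (L ^ 2 / t)) + -(c / 4 * (L ^ 2 / t)) by ring,
            Real.exp_add]
          ring
      _ ≤ 32 / c ^ 2 * Real.exp (4 / c) := mul_le_mul h1 h2 (by positivity) (by positivity)
      _ = 32 * Real.exp (4 / c) / c ^ 2 := by ring
      _ ≤ _ := le_add_of_nonneg_left hA

/-- Termwise bound for a non-trivial deck image `z̃` of `x̃` with deck label of norm `n ≥ 1`:
with `s = L²/(t+L) ≥ 1/2`, `d = L n` and `d²/(t+d) ≥ n s ≥ s - 1/2 + n/2`, so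
`exp(-c d²/(t+d)) ≤ e^{-cs} e^{c/2} · n e^{-(c/2) n}`. -/
private theorem term_le {N L : ℕ} [NeZero L] [NeZero (N * L)] {x z : TorusSite 4 (N * L)}
    (h : ∀ μ, ZMod.castHom (dvd_mul_left L N) (ZMod L) (z μ) =
      ZMod.castHom (dvd_mul_left L N) (ZMod L) (x μ)) (hne : z ≠ x) {c t : ℝ} (hc : 0 < c)
    (ht : 0 < t) (hs : (1 : ℝ) / 2 ≤ (L : ℝ) ^ 2 / (t + L)) :
    Real.exp (-(c * (torusDist x z : ℝ) ^ 2 / (t + (torusDist x z : ℝ)))) ≤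
      Real.exp (-(c * ((L : ℝ) ^ 2 / (t + L)))) * Real.exp (c / 2) *
        (((torusNorm (Ls := fun _ : Fin 4 => N)
            (fun μ => ((((z - x) μ).val / L : ℕ) : ZMod N)) : ℕ) : ℝ) *
          Real.exp (-(c / 2) * ((torusNorm (Ls := fun _ : Fin 4 => N)
            (fun μ => ((((z - x) μ).val / L : ℕ) : ZMod N)) : ℕ) : ℝ))) := by
  have hρ := one_le_torusNorm_deck h hne
  rw [torusDist_deck h]
  generalize torusNorm (Ls := fun _ : Fin 4 => N)
    (fun μ => ((((z - x) μ).val / L : ℕ) : ZMod N)) = n at hρ ⊢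
  have hL : (0 : ℝ) < L := Nat.cast_pos.mpr (Nat.pos_of_ne_zero (NeZero.ne L))
  have hn : (1 : ℝ) ≤ n := by exact_mod_cast hρ
  push_cast
  -- Step 1: `n s ≤ d²/(t+d)` for `d = L n`
  have key1 : (n : ℝ) * ((L : ℝ) ^ 2 / (t + L)) ≤ ((L : ℝ) * n) ^ 2 / (t + (L : ℝ) * n) := by
    rw [mul_div_assoc', div_le_div_iff₀ (by positivity) (by positivity)]
    have : 0 ≤ (L : ℝ) ^ 2 * n * t * (n - 1) := by
      have := sub_nonneg.2 hn
      positivity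
    nlinarith [this]
  -- Step 2: `c s - c/2 + (c/2) n ≤ c n s`
  have key2 : c * ((L : ℝ) ^ 2 / (t + L)) - c / 2 + c / 2 * n ≤
      c * ((n : ℝ) * ((L : ℝ) ^ 2 / (t + L))) := by
    have : 0 ≤ c * ((n : ℝ) - 1) * ((L : ℝ) ^ 2 / (t + L) - 1 / 2) := by
      have h1 := sub_nonneg.2 hn
      have h2 := sub_nonneg.2 hs
      positivity
    nlinarith [this]
  have key3 := mul_le_mul_of_nonneg_left key1 hc.le
  calc Real.exp (-(c * ((L : ℝ) * n) ^ 2 / (t + (L : ℝ) * n)))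
      ≤ Real.exp (-(c * ((L : ℝ) ^ 2 / (t + L))) + c / 2 + -(c / 2) * n) := by
        refine Real.exp_le_exp.2 ?_
        rw [mul_div_assoc]
        linarith
    _ = Real.exp (-(c * ((L : ℝ) ^ 2 / (t + L)))) * Real.exp (c / 2) *
          Real.exp (-(c / 2) * n) := by
        rw [Real.exp_add, Real.exp_add]
    _ ≤ _ := by
        refine mul_le_mul_of_nonneg_left ?_ (by positivity)
        exact le_mul_of_one_le_left (Real.exp_pos _).le hn

/-! ### The image sum -/

/-- **Exponential image sum in the core regime** (registered helper stub `stub_imageSumDG` of line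
`Sketch`, the lattice input of `stub_tracedCoreAssembly`): for every `c > 0` there is `C ≥ 0` such that on the
`N⁴`-sheeted cover `T_{NL} → T_L` (coordinatewise `ZMod.castHom`), for every site `x̃` and every
`t ≥ 1` with `t (1 + log t)² ≤ L²`,
`Σ_{z̃ ∈ π⁻¹(π x̃), z̃ ≠ x̃} exp(-c d(x̃,z̃)²/(t + d(x̃,z̃))) ≤ C / L⁴`.
Proof: deck images `x̃ + L k`, `k ∈ T_N ∖ {0}`, at distance `L ‖k‖` (`torusDist_deck`, `deck_inj`);
termwise `exp(-c d²/(t+d)) ≤ e^{-cL²/(t+L)} e^{c/2} ‖k‖ e^{-(c/2)‖k‖}` (`term_le`); radial summation on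
`T_N` (`small_torus_sum`, `radial_numeric`); absorption `e^{-cL²/(t+L)} ≤ C₂/L⁴` (`core_absorb`). -/
theorem stub_imageSumDG :
    ∀ c : ℝ, 0 < c → ∃ C : ℝ, 0 ≤ C ∧ ∀ (N L : ℕ) [NeZero L] [NeZero (N * L)]
      (x : TorusSite 4 (N * L)) (t : ℝ), 1 ≤ t → t * (1 + Real.log t) ^ 2 ≤ (L : ℝ) ^ 2 →
      ∑ z ∈ Finset.univ.filter (fun z : TorusSite 4 (N * L) =>
          (fun μ => ZMod.castHom (dvd_mul_left L N) (ZMod L) (z μ)) =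
            (fun μ => ZMod.castHom (dvd_mul_left L N) (ZMod L) (x μ)) ∧ z ≠ x),
        Real.exp (-(c * (torusDist x z : ℝ) ^ 2 / (t + (torusDist x z : ℝ)))) ≤ C / (L : ℝ) ^ 4 := by
  intro c hc
  obtain ⟨S, hS0, hS⟩ := radial_numeric hc
  have hC₂0 : (0 : ℝ) ≤ 384 / c ^ 4 + 32 * Real.exp (4 / c) / c ^ 2 := by positivity
  refine ⟨Real.exp (c / 2) * S * (384 / c ^ 4 + 32 * Real.exp (4 / c) / c ^ 2), by positivity,
    fun N L _ _ x t ht hreg => ?_⟩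
  haveI : NeZero N := neZero_left (L := L)
  have hL1 : (1 : ℝ) ≤ L := by exact_mod_cast Nat.one_le_iff_ne_zero.mpr (NeZero.ne L)
  have hL : (0 : ℝ) < L := by linarith
  have ht0 : (0 : ℝ) < t := by linarith
  -- the regime gives `t ≤ L²`, hence `L²/(t+L) ≥ 1/2`
  have hlog : 0 ≤ Real.log t := Real.log_nonneg ht
  have htL : t ≤ (L : ℝ) ^ 2 := by
    have h1 : t * 1 ≤ t * (1 + Real.log t) ^ 2 := mul_le_mul_of_nonneg_left (by nlinarith) ht0.le
    linarith
  have hs : (1 : ℝ) / 2 ≤ (L : ℝ) ^ 2 / (t + L) := by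
    rw [div_le_div_iff₀ (by norm_num) (by positivity)]
    nlinarith
  -- `exp(-c L²/(t+L)) ≤ C₂ / L⁴`
  have hq : Real.exp (-(c * ((L : ℝ) ^ 2 / (t + L)))) ≤
      (384 / c ^ 4 + 32 * Real.exp (4 / c) / c ^ 2) / (L : ℝ) ^ 4 := by
    rw [le_div_iff₀ (by positivity), mul_comm]
    exact core_absorb hc ht hL1 hreg
  -- compare with the radial sum on the small torus `T_N`
  have hsmall := small_torus_sum N (fun n : ℕ => (n : ℝ) * Real.exp (-(c / 2) * n))
    (fun n => by positivity)
  calc _ ≤ ∑ k : TorusSite 4 N, Real.exp (-(c * ((L : ℝ) ^ 2 / (t + L)))) * Real.exp (c / 2) *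
          (((torusNorm k : ℕ) : ℝ) * Real.exp (-(c / 2) * ((torusNorm k : ℕ) : ℝ))) := by
        refine sum_le_sum_of_injOn_nonneg
          (fun (z : TorusSite 4 (N * L)) (μ : Fin 4) => ((((z - x) μ).val / L : ℕ) : ZMod N))
          ?_ (fun z _ => Finset.mem_univ _) ?_ (fun k _ => by positivity)
        · intro z₁ hz₁ z₂ hz₂ heq
          simp only [Finset.coe_filter, Finset.mem_univ, true_and, Set.mem_setOf_eq] at hz₁ hz₂
          exact deck_inj (fun μ => congrFun hz₁.1 μ) (fun μ => congrFun hz₂.1 μ)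
            (fun μ => congrFun heq μ)
        · intro z hz
          rw [Finset.mem_filter] at hz
          exact term_le (fun μ => congrFun hz.2.1 μ) hz.2.2 hc ht0 hs
    _ = Real.exp (-(c * ((L : ℝ) ^ 2 / (t + L)))) * Real.exp (c / 2) *
          ∑ k : TorusSite 4 N, (((torusNorm k : ℕ) : ℝ) *
            Real.exp (-(c / 2) * ((torusNorm k : ℕ) : ℝ))) := by
        rw [Finset.mul_sum]
    _ ≤ (384 / c ^ 4 + 32 * Real.exp (4 / c) / c ^ 2) / (L : ℝ) ^ 4 * Real.exp (c / 2) * S :=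
        mul_le_mul (mul_le_mul_of_nonneg_right hq (Real.exp_pos _).le) (hsmall.trans (hS N))
          (Finset.sum_nonneg fun k _ => by positivity) (by positivity)
    _ = Real.exp (c / 2) * S * (384 / c ^ 4 + 32 * Real.exp (4 / c) / c ^ 2) / (L : ℝ) ^ 4 := by
        ring

end Summit.QuantumFields.QCD.Cruxes.TracedQuadraticParametrix.Sketch
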